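import Literature.AlgebraicGeometry.Motives.SmoothLocalCoordinates
import Mathlib.RingTheory.Etale.Kaehler
import Mathlib.RingTheory.IsTensorProduct
import HarnessLib

/-!
# Local coordinates relative to a base ring, and their transport along isomorphisms of local rings

Topic `Literature/AlgebraicGeometry/Motives` (proofs only; no definitions, no named facts). The
lemmas of `SmoothLocalCoordinates.lean` on the Jacobian of two systems of coordinates at a point
use nothing about the base being a field: here they are stated over an ARBITRARY base ring `A`
mapping compatibly to the local ring `𝒪_{X,x}` and to the function field `K(X)` of an integral
scheme `X` (the situation of a smooth morphism `X → S` at a point `x` over `s`, base `A = 𝒪_{S,s}`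
or `A = Γ(S, V)`; Bosch–Lütkebohmert–Raynaud, *Néron Models*, §2.2, relative étale coordinates):

* `exists_basis_functionField_of_localCoordinates'` — coordinates `z` at `x` relative to `A`
  (`d zᵢ` a basis of `Ω[𝒪_{X,x}⁄A]`) give a `K(X)`-basis `d zᵢ` of `Ω[K(X)⁄A]`;
* `isUnitAt_det_of_localCoordinates'`, `isUnitAt_mul_det_iff_of_localCoordinates'` — the
  relative Jacobian of two systems of coordinates at `x` is a unit at `x`, and the frame condition
  `IsUnitAt x (f₀ · B_z.det B₀)` does not depend on `z`;
* `exists_basis_of_bijective_eq_D` (ring form) and `exists_localCoordinates_of_isIso_stalkMap` —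
  **transport of coordinates along an isomorphism**: if `σ : 𝒪' → 𝒪` is a bijective `A`-algebra
  map (e.g. the stalk map of an isomorphism of `S`-schemes) and `d w'ᵢ` is a basis of `Ω[𝒪'⁄A]`,
  then `d (σ w'ᵢ)` is a basis of `Ω[𝒪⁄A]` (an isomorphism is formally étale, and `Ω` commutes with
  formally étale base change: Mathlib `KaehlerDifferential.isBaseChange_of_formallyEtale`;
  BLR §2.2 Cor. 10 for étale maps).

Cell `hodgecm-mathlib`, road W of `r₀` ((W0) relative infrastructure for the shear map
`Φ = (pr₁, m)` of `E × E` over `E`).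

## Sources

* S. Bosch, W. Lütkebohmert, M. Raynaud, *Néron Models*, Springer 1990, §2.2 (Prop. 11,
  Cor. 10). [BLRNeronModels1990]
-/

noncomputable section

universe u

open CategoryTheory AlgebraicGeometry Opposite

namespace Literature.AlgebraicGeometry.Motives

/-! ### Ring form: transport of exact bases along a bijective algebra map -/

section Ring

variable {A O O' : Type u} [CommRing A] [CommRing O] [CommRing O'] [Algebra A O] [Algebra A O']

/-- **Transport of coordinates along an isomorphism** (ring form): for a bijective ring map
`σ : O' → O` compatible with the `A`-algebra structures and `w' : ι → O'` with `d w'ᵢ` a basis of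
`Ω[O'⁄A]`, the family `d (σ w'ᵢ)` is a basis of `Ω[O⁄A]`: an isomorphism is formally étale, so
`Ω[O⁄A] = O ⊗_{O'} Ω[O'⁄A]` (Mathlib `KaehlerDifferential.isBaseChange_of_formallyEtale`).
[cite: BLRNeronModels1990, §2.2 Cor. 10] -/
theorem exists_basis_of_bijective_eq_D {ι : Type*} (σ : O' →+* O) (hσ : Function.Bijective σ)
    (hσA : σ.comp (algebraMap A O') = algebraMap A O) {w' : ι → O'}
    (b' : Module.Basis ι O' Ω[O'⁄A]) (hb' : ∀ i, b' i = KaehlerDifferential.D A O' (w' i)) :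
    ∃ b : Module.Basis ι O Ω[O⁄A], ∀ i, b i = KaehlerDifferential.D A O (σ (w' i)) := by
  letI : Algebra O' O := σ.toAlgebra
  haveI : IsScalarTower A O' O := IsScalarTower.of_algebraMap_eq fun a =>
    (RingHom.congr_fun hσA a).symm
  let e : O' ≃ₐ[O'] O := AlgEquiv.ofBijective (Algebra.ofId O' O) hσ
  haveI : Algebra.FormallyEtale O' O := Algebra.FormallyEtale.of_equiv e
  have h : IsBaseChange O (KaehlerDifferential.map A A O' O) :=
    KaehlerDifferential.isBaseChange_of_formallyEtale A O' O
  refine ⟨(b'.baseChange O).map h.equiv, fun i => ?_⟩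
  rw [Module.Basis.map_apply, Module.Basis.baseChange_apply, IsBaseChange.equiv_tmul, one_smul,
    hb', KaehlerDifferential.map_D]
  rfl

end Ring

/-! ### Relative coordinates at a point: Jacobians over a base ring -/

section Relative

open RatFn

variable {X : Scheme.{u}} [IsIntegral X] (n : ℕ) (A : Type u) [CommRing A] {x : X}
  [Algebra A (X.presheaf.stalk x)] [Algebra A X.functionField]
  [IsScalarTower A (X.presheaf.stalk x) X.functionField]

/-- **Relative coordinates at `x` give a basis of `Ω[K(X)⁄A]`**: if `d z₁, …, d zₙ` is a basis of
`Ω[𝒪_{X,x}⁄A]` then the images of the `zᵢ` in `K(X) = Frac 𝒪_{X,x}` have differentials forming a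
`K(X)`-basis of `Ω[K(X)⁄A]`. [cite: BLRNeronModels1990, §2.2 Prop. 11] -/
theorem exists_basis_functionField_of_localCoordinates' {z : Fin n → X.presheaf.stalk x}
    (b : Module.Basis (Fin n) (X.presheaf.stalk x) Ω[X.presheaf.stalk x⁄A])
    (hb : ∀ i, b i = KaehlerDifferential.D A _ (z i)) :
    ∃ B : Module.Basis (Fin n) X.functionField Ω[X.functionField⁄A],
      ∀ i, B i = KaehlerDifferential.D A _ (toFunctionField x (z i)) :=
  exists_basis_kaehler_localization_eq_D X.functionField (nonZeroDivisors (X.presheaf.stalk x)) b hb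

omit [Algebra A (X.presheaf.stalk x)] [IsScalarTower A (X.presheaf.stalk x) X.functionField] in
/-- A basis of `Ω[K(X)⁄A]` is determined by its values (private helper). [folklore] -/
private theorem basis_eq_of_localCoordinates' {z : Fin n → X.presheaf.stalk x}
    {B B₁ : Module.Basis (Fin n) X.functionField Ω[X.functionField⁄A]}
    (hB : ∀ i, B i = KaehlerDifferential.D A _ (toFunctionField x (z i)))
    (hB₁ : ∀ i, B₁ i = KaehlerDifferential.D A _ (toFunctionField x (z i))) : B = B₁ :=
  Module.Basis.eq_of_apply_eq fun i => (hB i).trans (hB₁ i).symm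

/-- **The relative Jacobian of two systems of coordinates at `x` is a unit at `x`**
(Bosch–Lütkebohmert–Raynaud §2.2 Prop. 11, relative to the base `A`): with `B, B'` the
`K(X)`-bases of `Ω[K(X)⁄A]` given by coordinates `z, z'` at `x`, `B'.det B ∈ K(X)` is the image of
`b'.det b ∈ 𝒪_{X,x}ˣ`, hence a unit at `x`. [cite: BLRNeronModels1990, §2.2 Prop. 11] -/
theorem isUnitAt_det_of_localCoordinates' {z z' : Fin n → X.presheaf.stalk x}
    (b : Module.Basis (Fin n) (X.presheaf.stalk x) Ω[X.presheaf.stalk x⁄A])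
    (hb : ∀ i, b i = KaehlerDifferential.D A _ (z i))
    (b' : Module.Basis (Fin n) (X.presheaf.stalk x) Ω[X.presheaf.stalk x⁄A])
    (hb' : ∀ i, b' i = KaehlerDifferential.D A _ (z' i))
    {B B' : Module.Basis (Fin n) X.functionField Ω[X.functionField⁄A]}
    (hB : ∀ i, B i = KaehlerDifferential.D A _ (toFunctionField x (z i)))
    (hB' : ∀ i, B' i = KaehlerDifferential.D A _ (toFunctionField x (z' i))) :
    B'.det B = toFunctionField x (b'.det b) ∧ IsUnitAt x (B'.det B) := by
  let L := KaehlerDifferential.map A A (X.presheaf.stalk x) X.functionField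
  have hBL : B = b.ofIsLocalizedModule X.functionField (nonZeroDivisors _) L :=
    basis_eq_of_localCoordinates' n A hB fun i => by
      rw [Module.Basis.ofIsLocalizedModule_apply, hb, KaehlerDifferential.map_D]
  have hB'L : B' = b'.ofIsLocalizedModule X.functionField (nonZeroDivisors _) L :=
    basis_eq_of_localCoordinates' n A hB' fun i => by
      rw [Module.Basis.ofIsLocalizedModule_apply, hb', KaehlerDifferential.map_D]
  have hdet : B'.det B = toFunctionField x (b'.det b) := by
    rw [Module.Basis.det_apply, Module.Basis.det_apply, RingHom.map_det]
    congr 1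
    ext i j
    rw [RingHom.mapMatrix_apply, Matrix.map_apply, Module.Basis.toMatrix_apply,
      Module.Basis.toMatrix_apply, hBL, hB'L, Module.Basis.ofIsLocalizedModule_apply,
      Module.Basis.ofIsLocalizedModule_repr_apply]
  refine ⟨hdet, ?_⟩
  obtain ⟨v, hv⟩ := b'.isUnit_det b
  exact ⟨v, by rw [hdet, hv]⟩

/-- **The frame condition at `x` does not depend on the relative coordinates**: for two systems of
coordinates `z, z'` at `x` relative to `A` (function-field bases `B, B'`) and a rational top form
`(f₀, B₀)` (`B₀` a basis of `Ω[K(X)⁄A]`), `f₀ · B.det B₀` is a unit at `x` iff `f₀ · B'.det B₀` is.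
[cite: BLRNeronModels1990, §2.2 Prop. 11] -/
theorem isUnitAt_mul_det_iff_of_localCoordinates' {z z' : Fin n → X.presheaf.stalk x}
    (b : Module.Basis (Fin n) (X.presheaf.stalk x) Ω[X.presheaf.stalk x⁄A])
    (hb : ∀ i, b i = KaehlerDifferential.D A _ (z i))
    (b' : Module.Basis (Fin n) (X.presheaf.stalk x) Ω[X.presheaf.stalk x⁄A])
    (hb' : ∀ i, b' i = KaehlerDifferential.D A _ (z' i))
    {B B' : Module.Basis (Fin n) X.functionField Ω[X.functionField⁄A]}
    (hB : ∀ i, B i = KaehlerDifferential.D A _ (toFunctionField x (z i)))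
    (hB' : ∀ i, B' i = KaehlerDifferential.D A _ (toFunctionField x (z' i)))
    (f₀ : X.functionField) (B₀ : Module.Basis (Fin n) X.functionField Ω[X.functionField⁄A]) :
    IsUnitAt x (f₀ * B.det B₀) ↔ IsUnitAt x (f₀ * B'.det B₀) := by
  have hJ : IsUnitAt x (B'.det B) := (isUnitAt_det_of_localCoordinates' n A b hb b' hb' hB hB').2
  have hcoc : B'.det B₀ = B'.det B * B.det B₀ := by
    rw [Module.Basis.det_apply, Module.Basis.det_apply, Module.Basis.det_apply, ← Matrix.det_mul,
      Module.Basis.toMatrix_mul_toMatrix]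
  constructor
  · intro h
    rw [hcoc, mul_left_comm]
    exact hJ.mul h
  · intro h
    have h' : IsUnitAt x ((f₀ * B'.det B₀) * (B'.det B)⁻¹) := h.mul hJ.inv
    rwa [hcoc, mul_comm (B'.det ⇑B) (B.det ⇑B₀), ← mul_assoc,
      mul_inv_cancel_right₀ hJ.ne_zero] at h'

end Relative

/-! ### Transport of coordinates along a morphism inducing an isomorphism of local rings -/

section Transport

open RatFn

variable {X Y : Scheme.{u}} [IsIntegral X] [IsIntegral Y] (Φ : X ⟶ Y) [IsDominant Φ] (n : ℕ)
  (A : Type u) [CommRing A] (x : X)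
  [Algebra A (X.presheaf.stalk x)] [Algebra A (Y.presheaf.stalk (Φ.base x))]

/-- **Pull-back of coordinates along a morphism inducing an isomorphism of local rings over `A`**
(e.g. an isomorphism of `S`-schemes, `A = 𝒪_{S,s}`): if `d w'₁, …, d w'ₙ` is a basis of
`Ω[𝒪_{Y,Φ x}⁄A]` then the images `Φ^♯_x w'ᵢ ∈ 𝒪_{X,x}` are coordinates at `x` relative to `A`, and
their rational functions are the pull-backs `Φ^♯ (w'ᵢ)` of the rational functions of the `w'ᵢ`
(`RatFn.functionFieldMap_toFunctionField`). [cite: BLRNeronModels1990, §2.2 Cor. 10] -/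
theorem exists_localCoordinates_of_isIso_stalkMap [IsIso (Φ.stalkMap x)]
    (hA : (Φ.stalkMap x).hom.comp (algebraMap A (Y.presheaf.stalk (Φ.base x))) =
      algebraMap A (X.presheaf.stalk x))
    {w' : Fin n → Y.presheaf.stalk (Φ.base x)}
    (b' : Module.Basis (Fin n) (Y.presheaf.stalk (Φ.base x)) Ω[Y.presheaf.stalk (Φ.base x)⁄A])
    (hb' : ∀ i, b' i = KaehlerDifferential.D A _ (w' i)) :
    ∃ (b : Module.Basis (Fin n) (X.presheaf.stalk x) Ω[X.presheaf.stalk x⁄A]),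
      (∀ i, b i = KaehlerDifferential.D A _ (Φ.stalkMap x (w' i))) ∧
      ∀ i, toFunctionField x (Φ.stalkMap x (w' i)) =
        functionFieldMap Φ (toFunctionField (Φ.base x) (w' i)) := by
  have hbij : Function.Bijective (Φ.stalkMap x).hom :=
    (ConcreteCategory.bijective_of_isIso (Φ.stalkMap x))
  obtain ⟨b, hb⟩ := exists_basis_of_bijective_eq_D (Φ.stalkMap x).hom hbij hA b' hb'
  exact ⟨b, hb, fun i => (functionFieldMap_toFunctionField Φ x (w' i)).symm⟩

end Transport

end Literature.AlgebraicGeometry.Motives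

end
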